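import Literature.NumberTheory.Automorphic.UnitaryGroupTorusRankOneIntervalTwo
import Literature.NumberTheory.Automorphic.UnitaryGroupRationalBorelCoveringWeights
import Literature.NumberTheory.Automorphic.UnitaryGroupHyperbolicBorelSliceTwo
import Literature.NumberTheory.Automorphic.UnitaryGroupTruncatedKernelIntegrableCM
import Literature.MeasureTheory.Group.InvariantQuotientChainRule
import HarnessLib

/-!
# The window constant of the adelic torus of `U(J₂)` (`N = 2` twin of `UnitaryGroupTorusWindowConstant`): for EVERY Haar measure `ρ` on `T(𝔸)` there is ONE `C_w < ∞`
# with `∫_{T(𝔸)} β'(t) · 1_{A < H(t) ≤ B} d(e_* ρ)(t) = C_w · (log B − log A)` for every covering weight `β'` of `T(F)`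
(Arthur, *The trace formula in invariant form*, Ann. of Math. 114 (1981), §2: the `T`-dependence of `J^T(f)` is the
volume of a truncated torus quotient, linear in `log T`; Rogawski, *Automorphic Representations of Unitary Groups in
Three Variables* (1990), §2.1 (p. 12) «each term is a polynomial in `log T`», §6.1 (6.1.3) (p. 80): the window law is
the source of the `2 log T` slope of the hyperbolic term.)

Topic `NumberTheory/Automorphic`; namespace `Literature.NumberTheory.Automorphic.UnitaryGroup`. THEOREMS ONLY over
accepted tree modules: no definition, no named fact, no instance, no notation, no `sorry`. Item (L5-ω)-window-two «THE
WINDOW LETTERS DISCHARGED, `N = 2`» (H-side factor `U(Φ₂)`) of the T1-qs LAW 5 road of `Cruxes/H413/Lines/F0_T1InnerFormTraceIdentity.lean` (cell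
`pub/hodgecm-mathlib`, crux H413). The regular hyperbolic socket closer of `U(J₂)` ★
`exists_rep_sum_filter_hyperbolic_classPolynomial_eval_zero_cm_two` (`UnitaryGroupHyperbolicSocketClosedTwo`) and the
two-socket skeletons over it carry the hyperbolic window data as LETTERS: a Haar measure `ρ` on `T(𝔸) = torusAdelic`, a constant `Cw ≠ ⊤` and the window law `hwin` of the transported
measure `e_* ρ` on `T(𝔸)_B = torusInBorel` (`e = (Subgroup.subgroupOfEquivOfLe torusAdelic_le_borelAdelic).symm`),
uniformly over the covering weights of the rational torus `T(F)_T = (rationalBorel).subgroupOf (torusInBorel)`. This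
file DISCHARGES the letters `(Cw, hC, hwin)` class-free: for every Haar `ρ` such a `Cw` exists — ★
`exists_rankOneInterval_forall_weight_two` (`UnitaryGroupTorusRankOneIntervalTwo`: one constant for all weights, from the
torus Siegel data ★ `exists_torusSiegelData_two` and the ray invariance ★ `exists_lintegral_weight_mul_indicator_window_eq`)
applied to `μ_T := e_* ρ` (a Haar measure: Mathlib `MulEquiv.isHaarMeasure_map` along the continuous isomorphism, ★
`continuous_subgroupOfEquivOfLe{_symm}`) and to ONE covering weight of `T(F)_T` (★ `exists_isCoveringWeight_torusInBorel`),
the Weyl representative being ★ `exists_rational_eq_weyl_two`.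

* §1 **`exists_torusWindowConstant_two`** (generic quadratic `(F, E, c)`, `[E:F] = 2`, `c² = 1 ≠ c`):
  `∃ Cw ≠ ⊤, ∀ β' covering, ∀ 0 < A ≤ B, ∫⁻ β'·1_{A < H ≤ B} d(e_* ρ) = Cw · (log B − log A)` — the `hwin` binder of ★
  `exists_rep_sum_filter_hyperbolic_classPolynomial_eval_zero_cm_two` VERBATIM.
* §2 **`exists_torusWindowConstant_cm_two`** — the CM pin `(L⁺, L, complexConj)`, hypothesis-free.

## References

* J. Arthur, *The trace formula in invariant form*, Ann. of Math. 114 (1981), §2 [Arthur1981TraceFormulaInvariantForm].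
* J. D. Rogawski, *Automorphic Representations of Unitary Groups in Three Variables*, Annals of Mathematics Studies 123
  (1990), §2.1 (p. 12), §6.1 (6.1.3) (p. 80) [Rogawski1990].
-/

set_option autoImplicit false

noncomputable section

open MeasureTheory Measure NumberField Set Literature.MeasureTheory.Group
open scoped NNReal ENNReal

namespace Literature.NumberTheory.Automorphic

namespace UnitaryGroup

/-! ## §1 The window constant of a Haar measure on `T(𝔸)` (generic quadratic `E/F`) -/

section Window

variable {F E : Type} [Field F] [NumberField F] [Field E] [NumberField E] [Algebra F E] {c : E ≃ₐ[F] E}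
  [MeasurableSpace (quasiSplit F E c 2).Adelic] [BorelSpace (quasiSplit F E c 2).Adelic]

/-- **THE WINDOW CONSTANT OF THE ADELIC TORUS OF `U(J₂)`.** For `[E:F] = 2`, `c² = 1`, `c ≠ 1` and EVERY Haar measure
`ρ` on `T(𝔸) = torusAdelic F E c 2` there is `Cw < ∞` such that, for every covering weight `β'` of the rational torus
`T(F)_T` on `T(𝔸)_B = torusInBorel F E c 2` and all `0 < A ≤ B`,
`∫⁻ β'(t) · 1_{A < H(t) ≤ B} d(e_* ρ)(t) = Cw · (log B − log A)` — the `T(F)`-covolume of the height window is linear in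
`log` (Arthur (1981), §2; Rogawski (1990), §2.1). This is the hyperbolic window letter `(Cw, hC, hwin)` of ★
`exists_rep_sum_filter_hyperbolic_classPolynomial_eval_zero_cm_two`, DISCHARGED: ★
`exists_rankOneInterval_forall_weight_two` at `μ_T := e_* ρ` (Haar by `MulEquiv.isHaarMeasure_map`) and one covering weight
(★ `exists_isCoveringWeight_torusInBorel`). [cite: Arthur1981TraceFormulaInvariantForm, §2]
[cite: Rogawski1990, §2.1 (p. 12), §6.1 (6.1.3) (p. 80)] -/
theorem exists_torusWindowConstant_two (h2 : Module.finrank F E = 2) (hc : c * c = 1) (hc1 : c ≠ 1)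
    (ρ : Measure ↥(torusAdelic F E c 2)) [ρ.IsHaarMeasure] :
    ∃ Cw : ℝ≥0∞, Cw ≠ ⊤ ∧
      ∀ β' : torusInBorel F E c 2 → ℝ≥0∞,
        IsCoveringWeight ((rationalBorel F E c 2).subgroupOf (torusInBorel F E c 2)) β' →
        ∀ A B : ℝ≥0, 0 < A → A ≤ B →
          ∫⁻ s : torusInBorel F E c 2, β' s *
            {s : torusInBorel F E c 2 |
              A < borelHeight (((s : torusInBorel F E c 2) : borelAdelic F E c 2) : (quasiSplit F E c 2).Adelic) ∧
              borelHeight (((s : torusInBorel F E c 2) : borelAdelic F E c 2) : (quasiSplit F E c 2).Adelic) ≤ B}.indicator 1 s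
            ∂(Measure.map (⇑(Subgroup.subgroupOfEquivOfLe
              (torusAdelic_le_borelAdelic (F := F) (E := E) (c := c) (N := 2))).symm) ρ :
                Measure (torusInBorel F E c 2)) =
            Cw * ENNReal.ofReal (Real.log (B : ℝ) - Real.log (A : ℝ)) := by
  -- `e_* ρ` is a Haar measure on `T(𝔸)_B`
  haveI : IsHaarMeasure (Measure.map (⇑(Subgroup.subgroupOfEquivOfLe
      (torusAdelic_le_borelAdelic (F := F) (E := E) (c := c) (N := 2))).symm) ρ : Measure (torusInBorel F E c 2)) :=
    MulEquiv.isHaarMeasure_map ρ _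
      (continuous_subgroupOfEquivOfLe_symm _ _ (torusAdelic_le_borelAdelic (F := F) (E := E) (c := c) (N := 2)))
      (continuous_subgroupOfEquivOfLe _ _ (torusAdelic_le_borelAdelic (F := F) (E := E) (c := c) (N := 2)))
  -- one covering weight of `T(F)_T` and the Weyl representative
  obtain ⟨β₀, hβ₀⟩ := exists_isCoveringWeight_torusInBorel (F := F) (E := E) (c := c) (N := 2)
  obtain ⟨w, hw⟩ := exists_rational_eq_weyl_two (F := F) (E := E) (c := c)
  obtain ⟨Cw, hC, hwin⟩ := exists_rankOneInterval_forall_weight_two h2 hc hc1 hw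
    (Measure.map (⇑(Subgroup.subgroupOfEquivOfLe
      (torusAdelic_le_borelAdelic (F := F) (E := E) (c := c) (N := 2))).symm) ρ : Measure (torusInBorel F E c 2)) hβ₀
  exact ⟨Cw, hC, fun β' hβ' => (hwin β' hβ').1⟩

end Window

/-! ## §2 The CM pin -/

section CM

/-- **THE WINDOW CONSTANT OF THE ADELIC TORUS, CM pin** `(L⁺, L, complexConj)` — §1 hypothesis-free (`[L:L⁺] = 2` by
Mathlib `IsCMField.isQuadraticExtension`, `c² = 1` ★ `complexConj_mul_complexConj`, `c ≠ 1` Mathlib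
`IsCMField.complexConj_ne_one`): for every Haar measure `ρ` on `T(𝔸)` there is `Cw ≠ ⊤` with the window law `hwin` of ★
`exists_rep_sum_filter_hyperbolic_classPolynomial_eval_zero_cm_two` for `e_* ρ` — so its letters
`{Cw} (hC) (hwin)` are supplied by `obtain ⟨Cw, hC, hwin⟩ := exists_torusWindowConstant_cm L ρ`.
[cite: Arthur1981TraceFormulaInvariantForm, §2] [cite: Rogawski1990, §2.1 (p. 12), §6.1 (6.1.3) (p. 80)] -/
theorem exists_torusWindowConstant_cm_two (L : Type) [Field L] [NumberField L] [IsCMField L]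
    [MeasurableSpace (quasiSplit (↥(maximalRealSubfield L)) L (IsCMField.complexConj L) 2).Adelic]
    [BorelSpace (quasiSplit (↥(maximalRealSubfield L)) L (IsCMField.complexConj L) 2).Adelic]
    (ρ : Measure ↥(torusAdelic (↥(maximalRealSubfield L)) L (IsCMField.complexConj L) 2)) [ρ.IsHaarMeasure] :
    ∃ Cw : ℝ≥0∞, Cw ≠ ⊤ ∧
      ∀ β' : torusInBorel (↥(maximalRealSubfield L)) L (IsCMField.complexConj L) 2 → ℝ≥0∞,
        IsCoveringWeight ((rationalBorel (↥(maximalRealSubfield L)) L (IsCMField.complexConj L) 2).subgroupOf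
          (torusInBorel (↥(maximalRealSubfield L)) L (IsCMField.complexConj L) 2)) β' →
        ∀ A B : ℝ≥0, 0 < A → A ≤ B →
          ∫⁻ s : torusInBorel (↥(maximalRealSubfield L)) L (IsCMField.complexConj L) 2, β' s *
            {s : torusInBorel (↥(maximalRealSubfield L)) L (IsCMField.complexConj L) 2 |
              A < borelHeight (((s : torusInBorel (↥(maximalRealSubfield L)) L (IsCMField.complexConj L) 2) :
                borelAdelic (↥(maximalRealSubfield L)) L (IsCMField.complexConj L) 2) :
                (quasiSplit (↥(maximalRealSubfield L)) L (IsCMField.complexConj L) 2).Adelic) ∧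
              borelHeight (((s : torusInBorel (↥(maximalRealSubfield L)) L (IsCMField.complexConj L) 2) :
                borelAdelic (↥(maximalRealSubfield L)) L (IsCMField.complexConj L) 2) :
                (quasiSplit (↥(maximalRealSubfield L)) L (IsCMField.complexConj L) 2).Adelic) ≤ B}.indicator 1 s
            ∂(Measure.map (⇑(Subgroup.subgroupOfEquivOfLe
              (torusAdelic_le_borelAdelic (F := ↥(maximalRealSubfield L)) (E := L) (c := IsCMField.complexConj L) (N := 2))).symm) ρ :
                Measure (torusInBorel (↥(maximalRealSubfield L)) L (IsCMField.complexConj L) 2)) =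
            Cw * ENNReal.ofReal (Real.log (B : ℝ) - Real.log (A : ℝ)) :=
  exists_torusWindowConstant_two (Algebra.IsQuadraticExtension.finrank_eq_two (↥(maximalRealSubfield L)) L)
    (complexConj_mul_complexConj L) (IsCMField.complexConj_ne_one L) ρ

end CM

end UnitaryGroup

end Literature.NumberTheory.Automorphic
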